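import Summits.QuantumAdvantage.AdviceFreeQNC0.AffBells22CoordProduct
import HarnessLib

/-!
# Cell qa-qnc0 (planner qa-qnc0-p1 g23, ROUND-22 §2.5): JUNTA PRODUCTS of signs versus an `𝔽₃`-character — LEMMA JPD in the
tree's `IsCoordProduct` / `ZMod.stdAddChar` language (generic index type, no cell objects)

Support for crux `RingDenseResidualLt3` (stmt-QuantumAdvantage-22907), route `DWalkThree`: the general-width replacement of
`AffBells22.norm_sum_coordProduct_mul_char_le` in the frame-averaging error term (`AffBells22FibreSum` / `AffBells22FrozenTwist`),
making `FrameAveraging` (all `w₀`) as elementary as `FrameAveragingOne` — no Viola–Wigderson input.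

* `mergeOn A b u` (coordinates in `A` from `b`, the rest from `u`), the involution `mergeSwap`, the averaging identity
  `sum_sum_mergeOn : Σ_b Σ_u f(mergeOn A b u) = 2^{|ι|} • Σ_v f v`;
* `ReadsOn S h` (the factor `h` reads only the coordinates in `S`);
* **`isCoordProduct_juntaProduct_mergeOn`**: if every `h_k` (`k ∈ s`) is `±1`-valued and reads `S_k`, and `A` meets every `S_k`
  at most once (a TRANSVERSAL), then on every part `{v | v|_(Aᶜ) = u}` the product `Π_k h_k` is a coordinate product;
* **`norm_sum_juntaProduct_mul_char_le`** (JPD): for such a product, any coordinate product `Ψ₀` and any `γ`,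
  `‖Σ_v Ψ₀(v)·Π_k h_k(v)·ω^{Σ_i [v_i]γ_i}‖ ≤ Π_i (i ∈ A ∧ γ_i ≠ 0 ? √3 : 2)`.
Proof: split the character along `A`, `norm_sum_coordProduct_mul_char_le` on each part, average over the parts.

PROVENANCE: authored by the planner seat qa-qnc0-p1 g23 (`HOME/qa-qnc0-p1/exp23/JuntaProduct23.lean`, farm rc 0), landed
verbatim by qn-prover-3 g12 (three one-line docstrings added); it generalises `AffBells22.norm_sum_coordProduct_mul_char_le`
(`AffBells22CoordProduct`) from width one to junta products with a transversal.

WHAT THIS IS NOT: no cell statement; the size of a transversal (Turán: `|A| ≥ w²/(w + Σ_k |S_k|(|S_k|−1))` inside a set of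
weight `w`) and the consumption in the fibre sums are separate steps.
-/

namespace Summit.QuantumAdvantage.AdviceFreeQNC0

open Finset
open Literature.Computability.MetaComplexity

namespace AffBells23

variable {ι : Type*} [Fintype ι] [DecidableEq ι]

/-! ## Merging along a set of coordinates -/

/-- Coordinates in `A` from `b`, the others from `u`. -/
def mergeOn (A : Finset ι) (b u : ι → Bool) : ι → Bool := fun i => if i ∈ A then b i else u i

omit [Fintype ι] in
/-- On `A` the merged pattern reads `b`. -/
theorem mergeOn_apply_of_mem {A : Finset ι} {i : ι} (h : i ∈ A) (b u : ι → Bool) : mergeOn A b u i = b i := by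
  unfold mergeOn; rw [if_pos h]

omit [Fintype ι] in
/-- Off `A` the merged pattern reads `u`. -/
theorem mergeOn_apply_of_not_mem {A : Finset ι} {i : ι} (h : i ∉ A) (b u : ι → Bool) : mergeOn A b u i = u i := by
  unfold mergeOn; rw [if_neg h]

omit [Fintype ι] in
/-- The merge involution identity. -/
theorem mergeOn_mergeOn (A : Finset ι) (b u u' : ι → Bool) :
    mergeOn A (mergeOn A b u') (mergeOn A u b) = b := by
  funext i
  unfold mergeOn
  by_cases hi : i ∈ A
  · rw [if_pos hi, if_pos hi]
  · rw [if_neg hi, if_neg hi]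

omit [Fintype ι] in
/-- The involution `(b, u) ↦ (mergeOn A b u, mergeOn A u b)`. -/
def mergeSwap (A : Finset ι) : ((ι → Bool) × (ι → Bool)) ≃ ((ι → Bool) × (ι → Bool)) where
  toFun p := (mergeOn A p.1 p.2, mergeOn A p.2 p.1)
  invFun p := (mergeOn A p.1 p.2, mergeOn A p.2 p.1)
  left_inv p := by
    obtain ⟨b, u⟩ := p
    simp only [mergeOn_mergeOn]
  right_inv p := by
    obtain ⟨b, u⟩ := p
    simp only [mergeOn_mergeOn]

/-- **Averaging identity**: `Σ_b Σ_u f(mergeOn A b u) = 2^{|ι|} • Σ_v f v`. -/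
theorem sum_sum_mergeOn {M : Type*} [AddCommMonoid M] (A : Finset ι) (f : (ι → Bool) → M) :
    ∑ b : ι → Bool, ∑ u : ι → Bool, f (mergeOn A b u) = 2 ^ Fintype.card ι • ∑ v : ι → Bool, f v := by
  have h1 : ∑ b : ι → Bool, ∑ u : ι → Bool, f (mergeOn A b u)
      = ∑ p : (ι → Bool) × (ι → Bool), f (mergeOn A p.1 p.2) := by
    rw [Fintype.sum_prod_type]
  have h2 : ∑ p : (ι → Bool) × (ι → Bool), f (mergeOn A p.1 p.2) = ∑ p : (ι → Bool) × (ι → Bool), f p.1 :=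
    Fintype.sum_equiv (mergeSwap A) _ _ (fun p => rfl)
  have h3 : ∑ p : (ι → Bool) × (ι → Bool), f p.1 = 2 ^ Fintype.card ι • ∑ v : ι → Bool, f v := by
    rw [Fintype.sum_prod_type]
    have inner : ∀ a : ι → Bool, (∑ _b : ι → Bool, f a) = 2 ^ Fintype.card ι • f a := by
      intro a
      rw [Finset.sum_const, Finset.card_univ, Fintype.card_fun, Fintype.card_bool]
    rw [Finset.sum_congr rfl (fun a _ => inner a), ← Finset.smul_sum]
  rw [h1, h2, h3]

/-! ## Junta factors and the transversal regrouping -/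

omit [Fintype ι] [DecidableEq ι] in
/-- `h` reads only the coordinates in `S`. -/
def ReadsOn (S : Finset ι) (h : (ι → Bool) → ℂ) : Prop := ∀ v v' : ι → Bool, (∀ i ∈ S, v i = v' i) → h v = h v'

/-- A coordinate product composed with `mergeOn A · u` is a coordinate product. -/
theorem isCoordProduct_comp_mergeOn {Ψ₀ : (ι → Bool) → ℂ} (hΨ₀ : AffBells22.IsCoordProduct Ψ₀) (A : Finset ι) (u : ι → Bool) :
    AffBells22.IsCoordProduct (fun b => Ψ₀ (mergeOn A b u)) := by
  obtain ⟨c, hc, g, hg, e⟩ := hΨ₀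
  refine ⟨c, hc, fun i β => if i ∈ A then g i β else g i (u i), ?_, fun b => ?_⟩
  · intro i β
    by_cases hi : i ∈ A
    · show (if i ∈ A then g i β else g i (u i)) = 1 ∨ (if i ∈ A then g i β else g i (u i)) = -1
      rw [if_pos hi]; exact hg i β
    · show (if i ∈ A then g i β else g i (u i)) = 1 ∨ (if i ∈ A then g i β else g i (u i)) = -1
      rw [if_neg hi]; exact hg i (u i)
  · show Ψ₀ (mergeOn A b u) = c * ∏ i, (if i ∈ A then g i (b i) else g i (u i))
    rw [e]
    congr 1
    refine Finset.prod_congr rfl fun i _ => ?_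
    unfold mergeOn
    by_cases hi : i ∈ A
    · rw [if_pos hi, if_pos hi]
    · rw [if_neg hi, if_neg hi]

/-- **Transversal regrouping**: if every `h_k` (`k ∈ s`) is `±1`-valued and reads `S_k`, and `|S_k ∩ A| ≤ 1` for all `k ∈ s`, then
for every `u` the function `b ↦ Π_{k ∈ s} h_k(mergeOn A b u)` is a coordinate product. -/
theorem isCoordProduct_juntaProduct_mergeOn {κ : Type*} (s : Finset κ) (S : κ → Finset ι) (h : κ → (ι → Bool) → ℂ)
    (hpm : ∀ k ∈ s, ∀ v, h k v = 1 ∨ h k v = -1) (hread : ∀ k ∈ s, ReadsOn (S k) (h k))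
    (A : Finset ι) (hA : ∀ k ∈ s, (S k ∩ A).card ≤ 1) (u : ι → Bool) :
    AffBells22.IsCoordProduct (fun b => ∏ k ∈ s, h k (mergeOn A b u)) := by
  classical
  set b₀ : ι → Bool := fun _ => false with hb₀
  set X : κ → (ι → Bool) → ℂ := fun k b => h k (mergeOn A b u) with hX
  set Kp : ι → Finset κ := fun p => s.filter fun k => p ∈ S k with hKp
  set K₀ : Finset κ := s.filter fun k => ∀ p ∈ A, p ∉ S k with hK₀
  set H : ι → Bool → ℂ := fun p β => ∏ k ∈ Kp p, X k (Function.update b₀ p β) with hH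
  have hXpm : ∀ k ∈ s, ∀ b, X k b = 1 ∨ X k b = -1 := fun k hk b => hpm k hk _
  have hHpm : ∀ p β, H p β = 1 ∨ H p β = -1 := by
    intro p β
    simp only [hH]
    refine Finset.prod_induction _ (fun x : ℂ => x = 1 ∨ x = -1) ?_ (Or.inl rfl)
      (fun k hk => hXpm k (Finset.mem_of_mem_filter k hk) _)
    rintro a c (rfl | rfl) (rfl | rfl) <;> norm_num
  -- `X k b` depends on `b` only through `b |_(S k ∩ A)`
  have hXread : ∀ k ∈ s, ∀ (b b' : ι → Bool), (∀ p ∈ A, p ∈ S k → b p = b' p) → X k b = X k b' := by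
    intro k hk b b' hbb'
    simp only [hX]
    apply hread k hk
    intro i hi
    unfold mergeOn
    by_cases hiA : i ∈ A
    · rw [if_pos hiA, if_pos hiA]
      exact hbb' i hiA hi
    · rw [if_neg hiA, if_neg hiA]
  -- the partition of the factors by their point in `A`
  have hs : s = K₀ ∪ A.biUnion Kp := by
    ext k
    simp only [mem_union, mem_biUnion, hK₀, hKp, mem_filter]
    constructor
    · intro hk
      by_cases hex : ∃ p ∈ A, p ∈ S k
      · obtain ⟨p, hpA, hpS⟩ := hex
        exact Or.inr ⟨p, hpA, hk, hpS⟩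
      · exact Or.inl ⟨hk, fun p hpA hpS => hex ⟨p, hpA, hpS⟩⟩
    · rintro (⟨hk, _⟩ | ⟨p, _, hk, _⟩) <;> exact hk
  have hdisj : Disjoint K₀ (A.biUnion Kp) := by
    rw [Finset.disjoint_left]
    intro k hk hk'
    simp only [hK₀, mem_filter] at hk
    simp only [mem_biUnion, hKp, mem_filter] at hk'
    obtain ⟨p, hpA, _, hpS⟩ := hk'
    exact hk.2 p hpA hpS
  have hpw : (A : Set ι).PairwiseDisjoint Kp := by
    intro p hp q hq hpq
    show Disjoint (Kp p) (Kp q)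
    rw [Finset.disjoint_left]
    intro k hkp hkq
    simp only [hKp, mem_filter] at hkp hkq
    exact hpq (Finset.card_le_one.mp (hA k hkp.1) p (mem_inter.mpr ⟨hkp.2, Finset.mem_coe.mp hp⟩)
      q (mem_inter.mpr ⟨hkq.2, Finset.mem_coe.mp hq⟩))
  -- the coordinate-product structure
  have hB : ∀ b : ι → Bool, ∏ k ∈ K₀, X k b = ∏ k ∈ K₀, X k b₀ := by
    intro b
    refine Finset.prod_congr rfl fun k hk => ?_
    simp only [hK₀, mem_filter] at hk
    exact hXread k hk.1 b b₀ fun p hpA hpS => absurd hpS (hk.2 p hpA)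
  have hC : ∀ b : ι → Bool, ∀ p ∈ A, ∏ k ∈ Kp p, X k b = H p (b p) := by
    intro b p hp
    simp only [hH]
    refine Finset.prod_congr rfl fun k hk => ?_
    simp only [hKp, mem_filter] at hk
    refine hXread k hk.1 b _ fun q hqA hqS => ?_
    have hqp : q = p := Finset.card_le_one.mp (hA k hk.1) q (mem_inter.mpr ⟨hqS, hqA⟩) p (mem_inter.mpr ⟨hk.2, hp⟩)
    rw [hqp, Function.update_self]
  have hc₀ : (∏ k ∈ K₀, X k b₀) = 1 ∨ (∏ k ∈ K₀, X k b₀) = -1 := by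
    refine Finset.prod_induction _ (fun x : ℂ => x = 1 ∨ x = -1) ?_ (Or.inl rfl)
      (fun k hk => hXpm k (Finset.mem_of_mem_filter k hk) _)
    rintro a c (rfl | rfl) (rfl | rfl) <;> norm_num
  have hrest : AffBells22.IsCoordProduct (fun b : ι → Bool => ∏ p ∈ A, H p (b p)) :=
    AffBells22.isCoordProduct_prod A (fun p b => H p (b p))
      (fun p _ => AffBells22.isCoordProduct_single p (H p) (hHpm p))
  have hall := (AffBells22.isCoordProduct_const (ι := ι) hc₀).mul hrest
  -- identify
  obtain ⟨c, hc, g, hg, e⟩ := hall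
  refine ⟨c, hc, g, hg, fun b => ?_⟩
  show (∏ k ∈ s, X k b) = _
  rw [← e b]
  show (∏ k ∈ s, X k b) = (∏ k ∈ K₀, X k b₀) * ∏ p ∈ A, H p (b p)
  rw [hs, Finset.prod_union hdisj, Finset.prod_biUnion hpw, hB b, Finset.prod_congr rfl (hC b)]

/-! ## JPD: junta product versus character -/

/-- The character splits along `A`. -/
theorem char_mergeOn (A : Finset ι) (γ : ι → ZMod 3) (b u : ι → Bool) :
    (∑ i, if mergeOn A b u i then γ i else 0)
      = (∑ i, if b i then (if i ∈ A then γ i else 0) else 0) + (∑ i, if u i then (if i ∈ A then 0 else γ i) else 0) := by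
  rw [← Finset.sum_add_distrib]
  refine Finset.sum_congr rfl fun i _ => ?_
  unfold mergeOn
  by_cases hi : i ∈ A
  · simp [hi]
  · simp [hi]

/-- **LEMMA JPD** (`norm_sum_juntaProduct_mul_char_le`): a product of `±1` junta factors with a TRANSVERSAL `A` (every reading set
meets `A` at most once), times any coordinate product, has character sums bounded by `Π_i (i ∈ A ∧ γ_i ≠ 0 ? √3 : 2)` — i.e.
`2^{|ι|}·(√3/2)^{#{i ∈ A : γ_i ≠ 0}}`.  No degree hypothesis; width enters only through the existence of large transversals. -/
theorem norm_sum_juntaProduct_mul_char_le {κ : Type*} (s : Finset κ) (S : κ → Finset ι) (h : κ → (ι → Bool) → ℂ)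
    (hpm : ∀ k ∈ s, ∀ v, h k v = 1 ∨ h k v = -1) (hread : ∀ k ∈ s, ReadsOn (S k) (h k))
    {Ψ₀ : (ι → Bool) → ℂ} (hΨ₀ : AffBells22.IsCoordProduct Ψ₀) (γ : ι → ZMod 3)
    (A : Finset ι) (hA : ∀ k ∈ s, (S k ∩ A).card ≤ 1) :
    ‖∑ v : ι → Bool, (Ψ₀ v * ∏ k ∈ s, h k v) * (ZMod.stdAddChar (∑ i, if v i then γ i else 0) : ℂ)‖
      ≤ ∏ i, (if i ∈ A ∧ γ i ≠ 0 then Real.sqrt 3 else 2) := by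
  classical
  set γA : ι → ZMod 3 := fun i => if i ∈ A then γ i else 0 with hγA
  set γO : ι → ZMod 3 := fun i => if i ∈ A then 0 else γ i with hγO
  set Φ : (ι → Bool) → ℂ := fun v => (Ψ₀ v * ∏ k ∈ s, h k v) * (ZMod.stdAddChar (∑ i, if v i then γ i else 0) : ℂ) with hΦ
  -- the bound on each part
  have hprod : (∏ i, (if γA i ≠ 0 then Real.sqrt 3 else 2)) = ∏ i, (if i ∈ A ∧ γ i ≠ 0 then Real.sqrt 3 else 2) := by
    refine Finset.prod_congr rfl fun i _ => ?_
    simp only [hγA]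
    by_cases hi : i ∈ A
    · simp [hi]
    · simp [hi]
  have hu : ∀ u : ι → Bool, ‖∑ b : ι → Bool, Φ (mergeOn A b u)‖ ≤ ∏ i, (if i ∈ A ∧ γ i ≠ 0 then Real.sqrt 3 else 2) := by
    intro u
    have hΨu := (isCoordProduct_comp_mergeOn hΨ₀ A u).mul
      (isCoordProduct_juntaProduct_mergeOn s S h hpm hread A hA u)
    have hcv := AffBells22.norm_sum_coordProduct_mul_char_le hΨu γA
    rw [hprod] at hcv
    have hrw : ∑ b : ι → Bool, Φ (mergeOn A b u)
        = (ZMod.stdAddChar (∑ i, if u i then γO i else 0) : ℂ) *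
          ∑ b : ι → Bool, (Ψ₀ (mergeOn A b u) * ∏ k ∈ s, h k (mergeOn A b u))
            * (ZMod.stdAddChar (∑ i, if b i then γA i else 0) : ℂ) := by
      rw [Finset.mul_sum]
      refine Finset.sum_congr rfl fun b _ => ?_
      simp only [hΦ]
      rw [char_mergeOn A γ b u, AddChar.map_add_eq_mul]
      ring
    rw [hrw, norm_mul, AffBells21.norm_stdAddChar_three, one_mul]
    exact hcv
  -- average over the parts
  have hid := sum_sum_mergeOn A Φ
  have h2 : ((2 : ℝ) ^ Fintype.card ι) ≠ 0 := pow_ne_zero _ two_ne_zero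
  have h2c : ((2 : ℂ) ^ Fintype.card ι) ≠ 0 := pow_ne_zero _ two_ne_zero
  have hsum : ∑ v : ι → Bool, Φ v = ((2 : ℂ) ^ Fintype.card ι)⁻¹ * ∑ u : ι → Bool, ∑ b : ι → Bool, Φ (mergeOn A b u) := by
    rw [Finset.sum_comm, hid, nsmul_eq_mul, Nat.cast_pow, Nat.cast_ofNat, ← mul_assoc, inv_mul_cancel₀ h2c, one_mul]
  show ‖∑ v : ι → Bool, Φ v‖ ≤ _
  rw [hsum, norm_mul, norm_inv, norm_pow, Complex.norm_two]
  calc ((2 : ℝ) ^ Fintype.card ι)⁻¹ * ‖∑ u : ι → Bool, ∑ b : ι → Bool, Φ (mergeOn A b u)‖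
      ≤ ((2 : ℝ) ^ Fintype.card ι)⁻¹ * ∑ u : ι → Bool, ‖∑ b : ι → Bool, Φ (mergeOn A b u)‖ :=
        mul_le_mul_of_nonneg_left (norm_sum_le _ _) (by positivity)
    _ ≤ ((2 : ℝ) ^ Fintype.card ι)⁻¹ * ∑ _u : ι → Bool, ∏ i, (if i ∈ A ∧ γ i ≠ 0 then Real.sqrt 3 else 2) :=
        mul_le_mul_of_nonneg_left (Finset.sum_le_sum fun u _ => hu u) (by positivity)
    _ = ∏ i, (if i ∈ A ∧ γ i ≠ 0 then Real.sqrt 3 else 2) := by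
        rw [Finset.sum_const, Finset.card_univ, Fintype.card_fun, Fintype.card_bool, nsmul_eq_mul]
        push_cast
        rw [← mul_assoc, inv_mul_cancel₀ h2, one_mul]

end AffBells23

end Summit.QuantumAdvantage.AdviceFreeQNC0
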